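import Summits.CriticalPhenomena.PercolationContinuityZ3.Theorems.PercAnnulusCrossingIICKernelCrossRatio
import Summits.CriticalPhenomena.PercolationContinuityZ3.Theorems.PercAnnulusCrossingIICInwardLink
import Summits.CriticalPhenomena.PercolationContinuityZ3.Theorems.PercAnnulusCrossingIICLevelTwoSided
import HarnessLib

/-!
# Kesten–Basu–Sapozhnikov IIC scheme in boxes, XIII: one level of Kesten's scheme (lane RSW3, p1 gen 3)

builds on p205010 (kernel theorem, internal audit signed; external expert review pending)

Seat `prim-rsw3-p1` (gen 3); LANE-4 blueprint, memo `run/shared/lean/prim/rsw3/P1-QM.md` §13.4 step (4).  Helper file; no definitions, no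
sorries; every `p`, `d`.  Notation of parts IV–XII.  One level of the scheme consists of an outer annulus `(2M₁, 2M₂)` carrying the outward
data `D = (U,R)`, an inward shell `(c,s) = (2μ₁ − 1, 2μ₂)` below it (`μ₂ ≤ M₁`), and inner data `C = (H,X)` with `H ⊆ Λ(μ₁−1)`,
`X ⊆ Λ(μ₁)`; the kernel is `M(C;D) = P(GOOD_in ∩ (LEFT(C;D) ∩ DAT(D) ∩ LINK'(D)))` and the level vectors are `γ_n(D) = P(CONN(D;n))`.
* **`sum_kernel_mul_conn_two_sided`** — Kesten's eq. (22) with junk: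
  `(1 − ϰ⁻²(α(2μ₁,2μ₂) + α(2M₁,2M₂))) · γ_n(C) ≤ Σ_D M(C;D) γ_n(D) ≤ γ_n(C)` (parts VI, VII, XII);
* `mul_le_kernel`, `kernel_le_mul` — the kernel is within the factor `ϰ` of the rank-one kernel `a(C) · β(D)`,
  `β(D) = Σ_I b(I) · P(REST(D;I))` (parts X, XI); in particular `M(C;D) > 0 ⟺ a(C) > 0 ∧ β(D) > 0`;
* `real_dat_eq_zero_of_mem_box` — data whose rim meets `Λ(b)` have `P(DAT) = 0`.
References: H. Kesten, PTRF 73 (1986) §2 eq. (22), Lemma (23); D. Basu, A. Sapozhnikov, ECP 22 (2017) no. 26, §2.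
-/

noncomputable section

namespace Summit.CriticalPhenomena.PercolationContinuityZ3.Theorems.Crossing

open MeasureTheory Literature.Probability.Percolation Literature.Probability.LatticeModels
open Literature.Probability.Percolation.DCT16
open Summit.CriticalPhenomena.PercolationContinuityZ3.Theorems.SurfaceTension
open scoped Literature.Probability.Percolation

variable {d : ℕ}

/-- **One level of Kesten's scheme, two-sided** (eq. (22) with junk): see the module docstring.
[cite: Kesten1986, §2 eq. (22)] [cite: BasuSapozhnikov2017ECP, §2 (2.5)–(2.7)] -/
theorem sum_kernel_mul_conn_two_sided (p : unitInterval) {ϰ : ℝ} (hϰ : 0 < ϰ)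
    (hA2 : ∀ m : ℕ, 1 ≤ m → ∀ Z : Finset (Site d), box d (4 * m) \ box d (m - 1) ⊆ Z →
      ∀ X : Finset (Site d), X ⊆ Z ∩ box d m → ∀ Y : Finset (Site d), Y ⊆ Z \ box d (4 * m) →
        ϰ * (bondPercolation (zdGraph d) p).real {ω | ∃ x ∈ X, ∃ s ∈ innerBoundary (zdGraph d) (box d (2 * m)),
              ω ∈ openConnIn (↑Z : Set (Site d)) x s} *
          (bondPercolation (zdGraph d) p).real {ω | ∃ y ∈ Y, ∃ s ∈ innerBoundary (zdGraph d) (box d (2 * m)),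
              ω ∈ openConnIn (↑Z : Set (Site d)) y s} ≤
        (bondPercolation (zdGraph d) p).real {ω | ∃ x ∈ X, ∃ y ∈ Y, ω ∈ openConnIn (↑Z : Set (Site d)) x y})
    {μ₁ μ₂ M₁ M₂ n : ℕ} (hμ₁ : 2 ≤ μ₁) (hμ12 : 4 * μ₁ < 2 * μ₂) (hμM : μ₂ ≤ M₁) (hM12 : 4 * M₁ < 2 * M₂) (hn : 4 * M₂ < n)
    {H X : Finset (Site d)} (hH : H ⊆ box d (μ₁ - 1)) (hX : X ⊆ box d μ₁) (hXH : ∀ x ∈ X, x ∉ H) :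
    (1 - ϰ⁻¹ ^ 2 * ((bondPercolation (zdGraph d) p).real (boxCrossing d (2 * μ₁) (2 * μ₂)) +
        (bondPercolation (zdGraph d) p).real (boxCrossing d (2 * M₁) (2 * M₂)))) *
        (bondPercolation (zdGraph d) p).real {ω : BondConfig (Site d) | ∃ x ∈ X, ∃ t ∈ innerBoundary (zdGraph d) (box d n),
            ω ∈ openConnIn ((↑(box d n) : Set (Site d)) \ ↑H) x t} ≤
      ∑ D ∈ ((box d (2 * M₂)).powerset.filter (fun U => box d (2 * M₁) ⊆ U)) ×ˢ (box d (2 * M₂ + 1)).powerset,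
        (bondPercolation (zdGraph d) p).real
        ((⋃ I ∈ (box d (2 * μ₂ - 1) \ box d (2 * μ₁ - 1)).powerset ×ˢ (innerBoundary (zdGraph d) (box d (2 * μ₁ - 1))).powerset,
            ({ω : BondConfig (Site d) | ω ∩ (↑((box d (2 * μ₂)).sym2) : Set (Sym2 (Site d))) ∈
                explEvent ((↑(box d (2 * μ₂ - 1)) : Set (Site d))ᶜ) ((↑(box d (2 * μ₂ - 1)) : Set (Site d)) \ ↑(box d (2 * μ₁ - 1)))
                  ((↑(box d (2 * μ₂ - 1)) : Set (Site d))ᶜ ∪ ↑I.1) ↑I.2} ∩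
             {ω : BondConfig (Site d) | ∀ y ∈ I.2, ∀ y' ∈ I.2, ∀ z ∈ I.1 ∪ innerBoundary (zdGraph d) (box d (2 * μ₂)),
                ∀ z' ∈ I.1 ∪ innerBoundary (zdGraph d) (box d (2 * μ₂)), s(z, y) ∈ ω → s(z', y') ∈ ω →
                ω ∈ openConnIn (↑(I.1 ∪ innerBoundary (zdGraph d) (box d (2 * μ₂))) : Set (Site d)) z z'})) ∩
          ({ω : BondConfig (Site d) | ∃ x ∈ X, ∃ r ∈ D.2, ∃ v ∈ D.1, ω ∈ openConnIn ((↑D.1 : Set (Site d)) \ ↑H) x v ∧ s(v, r) ∈ ω} ∩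
           {ω : BondConfig (Site d) | ω ∩ (↑((box d (2 * M₂ + 1)).sym2) : Set (Sym2 (Site d))) ∈
            explEvent (↑(box d (2 * M₁)) : Set (Site d)) ((↑(box d (2 * M₂)) : Set (Site d)) \ ↑(box d (2 * M₁))) ↑D.1 ↑D.2} ∩
           {ω : BondConfig (Site d) | ∀ r ∈ D.2, ∀ r' ∈ D.2, ∃ v ∈ D.1, ∃ v' ∈ D.1,
            s(v, r) ∈ ω ∧ s(v', r') ∈ ω ∧ ω ∈ openConnIn ((↑D.1 : Set (Site d)) \ ↑(box d (2 * M₁ - 1))) v v'})) *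
        (bondPercolation (zdGraph d) p).real {ω : BondConfig (Site d) | ∃ x ∈ D.2, ∃ t ∈ innerBoundary (zdGraph d) (box d n),
            ω ∈ openConnIn ((↑(box d n) : Set (Site d)) \ ↑D.1) x t} ∧
    ∑ D ∈ ((box d (2 * M₂)).powerset.filter (fun U => box d (2 * M₁) ⊆ U)) ×ˢ (box d (2 * M₂ + 1)).powerset,
        (bondPercolation (zdGraph d) p).real
        ((⋃ I ∈ (box d (2 * μ₂ - 1) \ box d (2 * μ₁ - 1)).powerset ×ˢ (innerBoundary (zdGraph d) (box d (2 * μ₁ - 1))).powerset,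
            ({ω : BondConfig (Site d) | ω ∩ (↑((box d (2 * μ₂)).sym2) : Set (Sym2 (Site d))) ∈
                explEvent ((↑(box d (2 * μ₂ - 1)) : Set (Site d))ᶜ) ((↑(box d (2 * μ₂ - 1)) : Set (Site d)) \ ↑(box d (2 * μ₁ - 1)))
                  ((↑(box d (2 * μ₂ - 1)) : Set (Site d))ᶜ ∪ ↑I.1) ↑I.2} ∩
             {ω : BondConfig (Site d) | ∀ y ∈ I.2, ∀ y' ∈ I.2, ∀ z ∈ I.1 ∪ innerBoundary (zdGraph d) (box d (2 * μ₂)),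
                ∀ z' ∈ I.1 ∪ innerBoundary (zdGraph d) (box d (2 * μ₂)), s(z, y) ∈ ω → s(z', y') ∈ ω →
                ω ∈ openConnIn (↑(I.1 ∪ innerBoundary (zdGraph d) (box d (2 * μ₂))) : Set (Site d)) z z'})) ∩
          ({ω : BondConfig (Site d) | ∃ x ∈ X, ∃ r ∈ D.2, ∃ v ∈ D.1, ω ∈ openConnIn ((↑D.1 : Set (Site d)) \ ↑H) x v ∧ s(v, r) ∈ ω} ∩
           {ω : BondConfig (Site d) | ω ∩ (↑((box d (2 * M₂ + 1)).sym2) : Set (Sym2 (Site d))) ∈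
            explEvent (↑(box d (2 * M₁)) : Set (Site d)) ((↑(box d (2 * M₂)) : Set (Site d)) \ ↑(box d (2 * M₁))) ↑D.1 ↑D.2} ∩
           {ω : BondConfig (Site d) | ∀ r ∈ D.2, ∀ r' ∈ D.2, ∃ v ∈ D.1, ∃ v' ∈ D.1,
            s(v, r) ∈ ω ∧ s(v', r') ∈ ω ∧ ω ∈ openConnIn ((↑D.1 : Set (Site d)) \ ↑(box d (2 * M₁ - 1))) v v'})) *
        (bondPercolation (zdGraph d) p).real {ω : BondConfig (Site d) | ∃ x ∈ D.2, ∃ t ∈ innerBoundary (zdGraph d) (box d n),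
            ω ∈ openConnIn ((↑(box d n) : Set (Site d)) \ ↑D.1) x t} ≤
      (bondPercolation (zdGraph d) p).real {ω : BondConfig (Site d) | ∃ x ∈ X, ∃ t ∈ innerBoundary (zdGraph d) (box d n),
            ω ∈ openConnIn ((↑(box d n) : Set (Site d)) \ ↑H) x t} := by
  classical
  set μ := bondPercolation (zdGraph d) p with hμ
  set G := (⋃ I ∈ (box d (2 * μ₂ - 1) \ box d (2 * μ₁ - 1)).powerset ×ˢ (innerBoundary (zdGraph d) (box d (2 * μ₁ - 1))).powerset,
            ({ω : BondConfig (Site d) | ω ∩ (↑((box d (2 * μ₂)).sym2) : Set (Sym2 (Site d))) ∈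
                explEvent ((↑(box d (2 * μ₂ - 1)) : Set (Site d))ᶜ) ((↑(box d (2 * μ₂ - 1)) : Set (Site d)) \ ↑(box d (2 * μ₁ - 1)))
                  ((↑(box d (2 * μ₂ - 1)) : Set (Site d))ᶜ ∪ ↑I.1) ↑I.2} ∩
             {ω : BondConfig (Site d) | ∀ y ∈ I.2, ∀ y' ∈ I.2, ∀ z ∈ I.1 ∪ innerBoundary (zdGraph d) (box d (2 * μ₂)),
                ∀ z' ∈ I.1 ∪ innerBoundary (zdGraph d) (box d (2 * μ₂)), s(z, y) ∈ ω → s(z', y') ∈ ω →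
                ω ∈ openConnIn (↑(I.1 ∪ innerBoundary (zdGraph d) (box d (2 * μ₂))) : Set (Site d)) z z'})) with hG
  set CO := {ω : BondConfig (Site d) | ∃ x ∈ X, ∃ t ∈ innerBoundary (zdGraph d) (box d n),
            ω ∈ openConnIn ((↑(box d n) : Set (Site d)) \ ↑H) x t} with hCO
  -- `GOOD_in` is determined by the pairs of `Λ(s)`
  have hGdet : DeterminedBy G (↑((box d (2 * μ₂)).sym2) : Set (Sym2 (Site d))) := by
    refine DeterminedBy.iUnion fun I => DeterminedBy.iUnion fun hI => ?_
    rw [Finset.mem_product, Finset.mem_powerset, Finset.mem_powerset] at hI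
    have hT : {e : Sym2 (Site d) | e ∈ (↑((box d (2 * μ₂)).sym2) : Set (Sym2 (Site d))) ∧
        ∃ v ∈ (↑(I.1 ∪ innerBoundary (zdGraph d) (box d (2 * μ₂))) : Set (Site d)), v ∈ e} ⊆ ↑((box d (2 * μ₂)).sym2) :=
      fun e he => he.1
    exact ((determinedBy_idat (c := 2 * μ₁ - 1) (by omega : 1 ≤ 2 * μ₂) I.1 I.2).mono hT).inter
      ((determinedBy_ilink (by omega : 2 * μ₁ - 1 ≤ 2 * μ₂) hI.1 hI.2).mono hT)
  have hF : (box d (2 * μ₂)).sym2 ⊆ (box d (2 * M₁)).sym2 := Finset.sym2_mono (box_mono d (by omega))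
  have h2 := sum_real_level_two_sided p hϰ hA2 (m₁ := M₁) (m₂ := M₂) (n := n) (by omega) hM12 hn
    (hH.trans (box_mono d (by omega))) (hX.trans (box_mono d (by omega))) hXH hGdet hF
  -- reorder the intersections in the summands
  have hsum : ∀ D : Finset (Site d) × Finset (Site d),
      G ∩ {ω : BondConfig (Site d) | ω ∩ (↑((box d (2 * M₂ + 1)).sym2) : Set (Sym2 (Site d))) ∈
            explEvent (↑(box d (2 * M₁)) : Set (Site d)) ((↑(box d (2 * M₂)) : Set (Site d)) \ ↑(box d (2 * M₁))) ↑D.1 ↑D.2} ∩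
        {ω : BondConfig (Site d) | ∀ r ∈ D.2, ∀ r' ∈ D.2, ∃ v ∈ D.1, ∃ v' ∈ D.1,
            s(v, r) ∈ ω ∧ s(v', r') ∈ ω ∧ ω ∈ openConnIn ((↑D.1 : Set (Site d)) \ ↑(box d (2 * M₁ - 1))) v v'} ∩
        {ω : BondConfig (Site d) | ∃ x ∈ X, ∃ r ∈ D.2, ∃ v ∈ D.1, ω ∈ openConnIn ((↑D.1 : Set (Site d)) \ ↑H) x v ∧ s(v, r) ∈ ω} =
      G ∩ ({ω : BondConfig (Site d) | ∃ x ∈ X, ∃ r ∈ D.2, ∃ v ∈ D.1, ω ∈ openConnIn ((↑D.1 : Set (Site d)) \ ↑H) x v ∧ s(v, r) ∈ ω} ∩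
        {ω : BondConfig (Site d) | ω ∩ (↑((box d (2 * M₂ + 1)).sym2) : Set (Sym2 (Site d))) ∈
            explEvent (↑(box d (2 * M₁)) : Set (Site d)) ((↑(box d (2 * M₂)) : Set (Site d)) \ ↑(box d (2 * M₁))) ↑D.1 ↑D.2} ∩
        {ω : BondConfig (Site d) | ∀ r ∈ D.2, ∀ r' ∈ D.2, ∃ v ∈ D.1, ∃ v' ∈ D.1,
            s(v, r) ∈ ω ∧ s(v', r') ∈ ω ∧ ω ∈ openConnIn ((↑D.1 : Set (Site d)) \ ↑(box d (2 * M₁ - 1))) v v'}) := by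
    intro D; ext ω; simp only [Set.mem_inter_iff]; tauto
  simp only [hsum] at h2
  -- the GOOD_in complement inside CONN
  have hGm : MeasurableSet G := hGdet.measurableSet_of_finset
  have hsplit : μ.real CO = μ.real (CO ∩ G) + μ.real (CO \ G) := (measureReal_inter_add_sdiff₀ hGm.nullMeasurableSet).symm
  have hjunk1 := real_inter_diff_goodIn_le p (c := 2 * μ₁ - 1) (s := 2 * μ₂) (by omega) CO
  rw [show 2 * μ₁ - 1 + 1 = 2 * μ₁ from by omega] at hjunk1
  have hjunk2 := real_conn_inter_nonuniq_le_of_setToSetQM p hϰ.le hA2 (m₁ := μ₁) (m₂ := μ₂) (n := n) (by omega) hμ12 (by omega)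
    hH hX hXH
  have hCG : μ.real (G ∩ CO) = μ.real (CO ∩ G) := by rw [Set.inter_comm]
  have hϰ2 : 0 < ϰ ^ 2 := by positivity
  have hdiff : μ.real (CO \ G) ≤ ϰ⁻¹ ^ 2 * (μ.real (boxCrossing d (2 * μ₁) (2 * μ₂)) * μ.real CO) := by
    rw [inv_pow, le_inv_mul_iff₀ hϰ2]
    exact (mul_le_mul_of_nonneg_left hjunk1 hϰ2.le).trans hjunk2
  constructor
  · have hlow := h2.1
    rw [hCG] at hlow
    have : (1 - ϰ⁻¹ ^ 2 * (μ.real (boxCrossing d (2 * μ₁) (2 * μ₂)) + μ.real (boxCrossing d (2 * M₁) (2 * M₂)))) * μ.real CO ≤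
        μ.real (CO ∩ G) - ϰ⁻¹ ^ 2 * μ.real (boxCrossing d (2 * M₁) (2 * M₂)) * μ.real CO := by
      nlinarith [hsplit, hdiff]
    exact this.trans hlow
  · have hup := h2.2
    rw [hCG] at hup
    exact hup.trans (by linarith [hsplit, measureReal_nonneg (μ := μ) (s := CO \ G)])

/-- **The kernel is within the factor `ϰ` of rank one**: `ϰ · a(H,X) · β(U,R) ≤ M((H,X);(U,R)) ≤ a(H,X) · β(U,R)` with
`a(H,X) = P(X ↔ ∂ⁱⁿΛ(2m) in Λ(2m) ∖ H)` and `β(U,R) = Σ_I b(I) · P(IDAT ∩ ILINK ∩ SECOND(U,R;I) ∩ DAT ∩ LINK')` (`1 ≤ m`, `2m + 1 ≤ μ₁`,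
`4μ₁ < 2μ₂ ≤ 2M₁ ≤ 2M₂`, `H ⊆ Λ(m−1)`, `X ⊆ Λ(m)`, `X ∩ H = ∅`, `Λ(2M₁) ⊆ U ⊆ Λ(2M₂)`, `R ⊆ Λ(2M₂+1) ∖ Λ(2M₂)`).
[cite: Kesten1986, §2 Lemma (23)] [cite: BasuSapozhnikov2017ECP, §2 (2.8)] -/
theorem mul_le_kernel_and_kernel_le_mul (p : unitInterval) {ϰ : ℝ} (hϰ : 0 ≤ ϰ)
    (hA2 : ∀ m : ℕ, 1 ≤ m → ∀ Z : Finset (Site d), box d (4 * m) \ box d (m - 1) ⊆ Z →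
      ∀ X : Finset (Site d), X ⊆ Z ∩ box d m → ∀ Y : Finset (Site d), Y ⊆ Z \ box d (4 * m) →
        ϰ * (bondPercolation (zdGraph d) p).real {ω | ∃ x ∈ X, ∃ s ∈ innerBoundary (zdGraph d) (box d (2 * m)),
              ω ∈ openConnIn (↑Z : Set (Site d)) x s} *
          (bondPercolation (zdGraph d) p).real {ω | ∃ y ∈ Y, ∃ s ∈ innerBoundary (zdGraph d) (box d (2 * m)),
              ω ∈ openConnIn (↑Z : Set (Site d)) y s} ≤
        (bondPercolation (zdGraph d) p).real {ω | ∃ x ∈ X, ∃ y ∈ Y, ω ∈ openConnIn (↑Z : Set (Site d)) x y})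
    {m μ₁ μ₂ M₁ M₂ : ℕ} (hm : 1 ≤ m) (hmμ : 2 * m + 1 ≤ μ₁) (hμ12 : 4 * μ₁ < 2 * μ₂) (hμM : μ₂ ≤ M₁) (hM : M₁ ≤ M₂)
    {H X U R : Finset (Site d)} (hH : H ⊆ box d (m - 1)) (hX : X ⊆ box d m) (hXH : ∀ x ∈ X, x ∉ H)
    (hUa : box d (2 * M₁) ⊆ U) (hUb : U ⊆ box d (2 * M₂)) (hR : R ⊆ box d (2 * M₂ + 1)) (hRb : ∀ r ∈ R, r ∉ box d (2 * M₂)) :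
    ϰ * (bondPercolation (zdGraph d) p).real {ω : BondConfig (Site d) | ∃ x ∈ X, ∃ w ∈ innerBoundary (zdGraph d) (box d (2 * m)),
          ω ∈ openConnIn ((↑(box d (2 * m)) : Set (Site d)) \ ↑H) x w} *
      (∑ I ∈ (box d (2 * μ₂ - 1) \ box d (2 * μ₁ - 1)).powerset ×ˢ (innerBoundary (zdGraph d) (box d (2 * μ₁ - 1))).powerset,
        (bondPercolation (zdGraph d) p).real {ω : BondConfig (Site d) | ∃ y ∈ I.2, ∃ w ∈ innerBoundary (zdGraph d) (box d (2 * m)),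
          ω ∈ openConnIn ((↑(box d (2 * μ₂)) : Set (Site d)) \ (↑(I.1 ∪ innerBoundary (zdGraph d) (box d (2 * μ₂))) ∪ ↑(box d (2 * m - 1)))) y w} *
        (bondPercolation (zdGraph d) p).real
          ({ω : BondConfig (Site d) | ω ∩ (↑((box d (2 * μ₂)).sym2) : Set (Sym2 (Site d))) ∈
                explEvent ((↑(box d (2 * μ₂ - 1)) : Set (Site d))ᶜ) ((↑(box d (2 * μ₂ - 1)) : Set (Site d)) \ ↑(box d (2 * μ₁ - 1)))
                  ((↑(box d (2 * μ₂ - 1)) : Set (Site d))ᶜ ∪ ↑I.1) ↑I.2} ∩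
           {ω : BondConfig (Site d) | ∀ y ∈ I.2, ∀ y' ∈ I.2, ∀ z ∈ I.1 ∪ innerBoundary (zdGraph d) (box d (2 * μ₂)),
                ∀ z' ∈ I.1 ∪ innerBoundary (zdGraph d) (box d (2 * μ₂)), s(z, y) ∈ ω → s(z', y') ∈ ω →
                ω ∈ openConnIn (↑(I.1 ∪ innerBoundary (zdGraph d) (box d (2 * μ₂))) : Set (Site d)) z z'} ∩
           {ω : BondConfig (Site d) | ∃ y ∈ I.2, ∃ z ∈ I.1 ∪ innerBoundary (zdGraph d) (box d (2 * μ₂)), s(z, y) ∈ ω ∧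
            ∃ r ∈ R, ∃ v ∈ U, ω ∈ openConnIn ((↑(I.1 ∪ innerBoundary (zdGraph d) (box d (2 * μ₂))) : Set (Site d)) ∪ (↑U \ ↑(box d (2 * μ₂)))) z v ∧
              s(v, r) ∈ ω} ∩
           {ω : BondConfig (Site d) | ω ∩ (↑((box d (2 * M₂ + 1)).sym2) : Set (Sym2 (Site d))) ∈
            explEvent (↑(box d (2 * M₁)) : Set (Site d)) ((↑(box d (2 * M₂)) : Set (Site d)) \ ↑(box d (2 * M₁))) ↑U ↑R} ∩
           {ω : BondConfig (Site d) | ∀ r ∈ R, ∀ r' ∈ R, ∃ v ∈ U, ∃ v' ∈ U,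
            s(v, r) ∈ ω ∧ s(v', r') ∈ ω ∧ ω ∈ openConnIn ((↑U : Set (Site d)) \ ↑(box d (2 * M₁ - 1))) v v'})) ≤
      (bondPercolation (zdGraph d) p).real
        ((⋃ I ∈ (box d (2 * μ₂ - 1) \ box d (2 * μ₁ - 1)).powerset ×ˢ (innerBoundary (zdGraph d) (box d (2 * μ₁ - 1))).powerset,
            ({ω : BondConfig (Site d) | ω ∩ (↑((box d (2 * μ₂)).sym2) : Set (Sym2 (Site d))) ∈
                explEvent ((↑(box d (2 * μ₂ - 1)) : Set (Site d))ᶜ) ((↑(box d (2 * μ₂ - 1)) : Set (Site d)) \ ↑(box d (2 * μ₁ - 1)))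
                  ((↑(box d (2 * μ₂ - 1)) : Set (Site d))ᶜ ∪ ↑I.1) ↑I.2} ∩
             {ω : BondConfig (Site d) | ∀ y ∈ I.2, ∀ y' ∈ I.2, ∀ z ∈ I.1 ∪ innerBoundary (zdGraph d) (box d (2 * μ₂)),
                ∀ z' ∈ I.1 ∪ innerBoundary (zdGraph d) (box d (2 * μ₂)), s(z, y) ∈ ω → s(z', y') ∈ ω →
                ω ∈ openConnIn (↑(I.1 ∪ innerBoundary (zdGraph d) (box d (2 * μ₂))) : Set (Site d)) z z'})) ∩
          ({ω : BondConfig (Site d) | ∃ x ∈ X, ∃ r ∈ R, ∃ v ∈ U, ω ∈ openConnIn ((↑U : Set (Site d)) \ ↑H) x v ∧ s(v, r) ∈ ω} ∩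
           {ω : BondConfig (Site d) | ω ∩ (↑((box d (2 * M₂ + 1)).sym2) : Set (Sym2 (Site d))) ∈
            explEvent (↑(box d (2 * M₁)) : Set (Site d)) ((↑(box d (2 * M₂)) : Set (Site d)) \ ↑(box d (2 * M₁))) ↑U ↑R} ∩
           {ω : BondConfig (Site d) | ∀ r ∈ R, ∀ r' ∈ R, ∃ v ∈ U, ∃ v' ∈ U,
            s(v, r) ∈ ω ∧ s(v', r') ∈ ω ∧ ω ∈ openConnIn ((↑U : Set (Site d)) \ ↑(box d (2 * M₁ - 1))) v v'})) ∧
    (bondPercolation (zdGraph d) p).real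
        ((⋃ I ∈ (box d (2 * μ₂ - 1) \ box d (2 * μ₁ - 1)).powerset ×ˢ (innerBoundary (zdGraph d) (box d (2 * μ₁ - 1))).powerset,
            ({ω : BondConfig (Site d) | ω ∩ (↑((box d (2 * μ₂)).sym2) : Set (Sym2 (Site d))) ∈
                explEvent ((↑(box d (2 * μ₂ - 1)) : Set (Site d))ᶜ) ((↑(box d (2 * μ₂ - 1)) : Set (Site d)) \ ↑(box d (2 * μ₁ - 1)))
                  ((↑(box d (2 * μ₂ - 1)) : Set (Site d))ᶜ ∪ ↑I.1) ↑I.2} ∩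
             {ω : BondConfig (Site d) | ∀ y ∈ I.2, ∀ y' ∈ I.2, ∀ z ∈ I.1 ∪ innerBoundary (zdGraph d) (box d (2 * μ₂)),
                ∀ z' ∈ I.1 ∪ innerBoundary (zdGraph d) (box d (2 * μ₂)), s(z, y) ∈ ω → s(z', y') ∈ ω →
                ω ∈ openConnIn (↑(I.1 ∪ innerBoundary (zdGraph d) (box d (2 * μ₂))) : Set (Site d)) z z'})) ∩
          ({ω : BondConfig (Site d) | ∃ x ∈ X, ∃ r ∈ R, ∃ v ∈ U, ω ∈ openConnIn ((↑U : Set (Site d)) \ ↑H) x v ∧ s(v, r) ∈ ω} ∩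
           {ω : BondConfig (Site d) | ω ∩ (↑((box d (2 * M₂ + 1)).sym2) : Set (Sym2 (Site d))) ∈
            explEvent (↑(box d (2 * M₁)) : Set (Site d)) ((↑(box d (2 * M₂)) : Set (Site d)) \ ↑(box d (2 * M₁))) ↑U ↑R} ∩
           {ω : BondConfig (Site d) | ∀ r ∈ R, ∀ r' ∈ R, ∃ v ∈ U, ∃ v' ∈ U,
            s(v, r) ∈ ω ∧ s(v', r') ∈ ω ∧ ω ∈ openConnIn ((↑U : Set (Site d)) \ ↑(box d (2 * M₁ - 1))) v v'})) ≤
      (bondPercolation (zdGraph d) p).real {ω : BondConfig (Site d) | ∃ x ∈ X, ∃ w ∈ innerBoundary (zdGraph d) (box d (2 * m)),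
          ω ∈ openConnIn ((↑(box d (2 * m)) : Set (Site d)) \ ↑H) x w} *
      (∑ I ∈ (box d (2 * μ₂ - 1) \ box d (2 * μ₁ - 1)).powerset ×ˢ (innerBoundary (zdGraph d) (box d (2 * μ₁ - 1))).powerset,
        (bondPercolation (zdGraph d) p).real {ω : BondConfig (Site d) | ∃ y ∈ I.2, ∃ w ∈ innerBoundary (zdGraph d) (box d (2 * m)),
          ω ∈ openConnIn ((↑(box d (2 * μ₂)) : Set (Site d)) \ (↑(I.1 ∪ innerBoundary (zdGraph d) (box d (2 * μ₂))) ∪ ↑(box d (2 * m - 1)))) y w} *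
        (bondPercolation (zdGraph d) p).real
          ({ω : BondConfig (Site d) | ω ∩ (↑((box d (2 * μ₂)).sym2) : Set (Sym2 (Site d))) ∈
                explEvent ((↑(box d (2 * μ₂ - 1)) : Set (Site d))ᶜ) ((↑(box d (2 * μ₂ - 1)) : Set (Site d)) \ ↑(box d (2 * μ₁ - 1)))
                  ((↑(box d (2 * μ₂ - 1)) : Set (Site d))ᶜ ∪ ↑I.1) ↑I.2} ∩
           {ω : BondConfig (Site d) | ∀ y ∈ I.2, ∀ y' ∈ I.2, ∀ z ∈ I.1 ∪ innerBoundary (zdGraph d) (box d (2 * μ₂)),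
                ∀ z' ∈ I.1 ∪ innerBoundary (zdGraph d) (box d (2 * μ₂)), s(z, y) ∈ ω → s(z', y') ∈ ω →
                ω ∈ openConnIn (↑(I.1 ∪ innerBoundary (zdGraph d) (box d (2 * μ₂))) : Set (Site d)) z z'} ∩
           {ω : BondConfig (Site d) | ∃ y ∈ I.2, ∃ z ∈ I.1 ∪ innerBoundary (zdGraph d) (box d (2 * μ₂)), s(z, y) ∈ ω ∧
            ∃ r ∈ R, ∃ v ∈ U, ω ∈ openConnIn ((↑(I.1 ∪ innerBoundary (zdGraph d) (box d (2 * μ₂))) : Set (Site d)) ∪ (↑U \ ↑(box d (2 * μ₂)))) z v ∧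
              s(v, r) ∈ ω} ∩
           {ω : BondConfig (Site d) | ω ∩ (↑((box d (2 * M₂ + 1)).sym2) : Set (Sym2 (Site d))) ∈
            explEvent (↑(box d (2 * M₁)) : Set (Site d)) ((↑(box d (2 * M₂)) : Set (Site d)) \ ↑(box d (2 * M₁))) ↑U ↑R} ∩
           {ω : BondConfig (Site d) | ∀ r ∈ R, ∀ r' ∈ R, ∃ v ∈ U, ∃ v' ∈ U,
            s(v, r) ∈ ω ∧ s(v', r') ∈ ω ∧ ω ∈ openConnIn ((↑U : Set (Site d)) \ ↑(box d (2 * M₁ - 1))) v v'})) := by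
  classical
  have hc : 1 ≤ 2 * μ₁ - 1 := by omega
  have hcs : 2 * μ₁ - 1 + 2 ≤ 2 * μ₂ := by omega
  have hHc : H ⊆ box d (2 * μ₁ - 1 - 1) := hH.trans (box_mono d (by omega))
  have hXc : X ⊆ box d (2 * μ₁ - 1 - 1) := hX.trans (box_mono d (by omega))
  rw [← sum_real_kernel_eq p hc hcs (by omega : 2 * μ₂ ≤ 2 * M₁) (by omega : 2 * M₁ ≤ 2 * M₂) hHc hXc hUa hUb hR hRb,
    Finset.mul_sum, Finset.mul_sum]
  constructor
  · refine Finset.sum_le_sum fun I hI => ?_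
    rw [Finset.mem_product, Finset.mem_powerset, Finset.mem_powerset] at hI
    have h := mul_le_real_first p hϰ hA2 hm (by omega : 4 * m ≤ 2 * μ₁ - 1 - 1) (by omega : 2 * μ₁ - 1 < 2 * μ₂) hH hX hXH hI.1 hI.2
    calc _ = (ϰ * (bondPercolation (zdGraph d) p).real {ω : BondConfig (Site d) | ∃ x ∈ X, ∃ w ∈ innerBoundary (zdGraph d) (box d (2 * m)),
          ω ∈ openConnIn ((↑(box d (2 * m)) : Set (Site d)) \ ↑H) x w} *
          (bondPercolation (zdGraph d) p).real {ω : BondConfig (Site d) | ∃ y ∈ I.2, ∃ w ∈ innerBoundary (zdGraph d) (box d (2 * m)),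
          ω ∈ openConnIn ((↑(box d (2 * μ₂)) : Set (Site d)) \ (↑(I.1 ∪ innerBoundary (zdGraph d) (box d (2 * μ₂))) ∪ ↑(box d (2 * m - 1)))) y w}) *
          (bondPercolation (zdGraph d) p).real
            ({ω : BondConfig (Site d) | ω ∩ (↑((box d (2 * μ₂)).sym2) : Set (Sym2 (Site d))) ∈
                explEvent ((↑(box d (2 * μ₂ - 1)) : Set (Site d))ᶜ) ((↑(box d (2 * μ₂ - 1)) : Set (Site d)) \ ↑(box d (2 * μ₁ - 1)))
                  ((↑(box d (2 * μ₂ - 1)) : Set (Site d))ᶜ ∪ ↑I.1) ↑I.2} ∩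
           {ω : BondConfig (Site d) | ∀ y ∈ I.2, ∀ y' ∈ I.2, ∀ z ∈ I.1 ∪ innerBoundary (zdGraph d) (box d (2 * μ₂)),
                ∀ z' ∈ I.1 ∪ innerBoundary (zdGraph d) (box d (2 * μ₂)), s(z, y) ∈ ω → s(z', y') ∈ ω →
                ω ∈ openConnIn (↑(I.1 ∪ innerBoundary (zdGraph d) (box d (2 * μ₂))) : Set (Site d)) z z'} ∩
           {ω : BondConfig (Site d) | ∃ y ∈ I.2, ∃ z ∈ I.1 ∪ innerBoundary (zdGraph d) (box d (2 * μ₂)), s(z, y) ∈ ω ∧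
            ∃ r ∈ R, ∃ v ∈ U, ω ∈ openConnIn ((↑(I.1 ∪ innerBoundary (zdGraph d) (box d (2 * μ₂))) : Set (Site d)) ∪ (↑U \ ↑(box d (2 * μ₂)))) z v ∧
              s(v, r) ∈ ω} ∩
           {ω : BondConfig (Site d) | ω ∩ (↑((box d (2 * M₂ + 1)).sym2) : Set (Sym2 (Site d))) ∈
            explEvent (↑(box d (2 * M₁)) : Set (Site d)) ((↑(box d (2 * M₂)) : Set (Site d)) \ ↑(box d (2 * M₁))) ↑U ↑R} ∩
           {ω : BondConfig (Site d) | ∀ r ∈ R, ∀ r' ∈ R, ∃ v ∈ U, ∃ v' ∈ U,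
            s(v, r) ∈ ω ∧ s(v', r') ∈ ω ∧ ω ∈ openConnIn ((↑U : Set (Site d)) \ ↑(box d (2 * M₁ - 1))) v v'}) := by ring
      _ ≤ _ := mul_le_mul_of_nonneg_right h measureReal_nonneg
  · refine Finset.sum_le_sum fun I hI => ?_
    rw [Finset.mem_product, Finset.mem_powerset, Finset.mem_powerset] at hI
    have h := real_first_le_mul p (2 * μ₂) hm (by omega : 2 * m ≤ 2 * μ₁ - 1) (H := H) (Xs := I.1) hX hI.2
    calc _ ≤ ((bondPercolation (zdGraph d) p).real {ω : BondConfig (Site d) | ∃ x ∈ X, ∃ w ∈ innerBoundary (zdGraph d) (box d (2 * m)),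
          ω ∈ openConnIn ((↑(box d (2 * m)) : Set (Site d)) \ ↑H) x w} *
          (bondPercolation (zdGraph d) p).real {ω : BondConfig (Site d) | ∃ y ∈ I.2, ∃ w ∈ innerBoundary (zdGraph d) (box d (2 * m)),
          ω ∈ openConnIn ((↑(box d (2 * μ₂)) : Set (Site d)) \ (↑(I.1 ∪ innerBoundary (zdGraph d) (box d (2 * μ₂))) ∪ ↑(box d (2 * m - 1)))) y w}) *
          (bondPercolation (zdGraph d) p).real
            ({ω : BondConfig (Site d) | ω ∩ (↑((box d (2 * μ₂)).sym2) : Set (Sym2 (Site d))) ∈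
                explEvent ((↑(box d (2 * μ₂ - 1)) : Set (Site d))ᶜ) ((↑(box d (2 * μ₂ - 1)) : Set (Site d)) \ ↑(box d (2 * μ₁ - 1)))
                  ((↑(box d (2 * μ₂ - 1)) : Set (Site d))ᶜ ∪ ↑I.1) ↑I.2} ∩
           {ω : BondConfig (Site d) | ∀ y ∈ I.2, ∀ y' ∈ I.2, ∀ z ∈ I.1 ∪ innerBoundary (zdGraph d) (box d (2 * μ₂)),
                ∀ z' ∈ I.1 ∪ innerBoundary (zdGraph d) (box d (2 * μ₂)), s(z, y) ∈ ω → s(z', y') ∈ ω →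
                ω ∈ openConnIn (↑(I.1 ∪ innerBoundary (zdGraph d) (box d (2 * μ₂))) : Set (Site d)) z z'} ∩
           {ω : BondConfig (Site d) | ∃ y ∈ I.2, ∃ z ∈ I.1 ∪ innerBoundary (zdGraph d) (box d (2 * μ₂)), s(z, y) ∈ ω ∧
            ∃ r ∈ R, ∃ v ∈ U, ω ∈ openConnIn ((↑(I.1 ∪ innerBoundary (zdGraph d) (box d (2 * μ₂))) : Set (Site d)) ∪ (↑U \ ↑(box d (2 * μ₂)))) z v ∧
              s(v, r) ∈ ω} ∩
           {ω : BondConfig (Site d) | ω ∩ (↑((box d (2 * M₂ + 1)).sym2) : Set (Sym2 (Site d))) ∈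
            explEvent (↑(box d (2 * M₁)) : Set (Site d)) ((↑(box d (2 * M₂)) : Set (Site d)) \ ↑(box d (2 * M₁))) ↑U ↑R} ∩
           {ω : BondConfig (Site d) | ∀ r ∈ R, ∀ r' ∈ R, ∃ v ∈ U, ∃ v' ∈ U,
            s(v, r) ∈ ω ∧ s(v', r') ∈ ω ∧ ω ∈ openConnIn ((↑U : Set (Site d)) \ ↑(box d (2 * M₁ - 1))) v v'}) := mul_le_mul_of_nonneg_right h measureReal_nonneg
      _ = _ := by ring

/-- Data whose rim meets `Λ(b)` never occur: `r ∈ R ∩ Λ(b) ⇒ P(DAT(U,R)) = 0` (`a ≤ b`, `U ⊆ Λ(b)`). [cite: BasuSapozhnikov2017ECP, §2] -/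
theorem real_dat_eq_zero_of_mem_box (p : unitInterval) {a b : ℕ} (hab : a ≤ b) {U R : Finset (Site d)} (hUb : U ⊆ box d b)
    {r : Site d} (hr : r ∈ R) (hrb : r ∈ box d b) :
    (bondPercolation (zdGraph d) p).real {ω : BondConfig (Site d) | ω ∩ (↑((box d (b + 1)).sym2) : Set (Sym2 (Site d))) ∈
            explEvent (↑(box d (a)) : Set (Site d)) ((↑(box d (b)) : Set (Site d)) \ ↑(box d (a))) ↑U ↑R} = 0 := by
  rw [real_congr_of_forall_subset_edgeSet (zdGraph d) p (B := ∅) (fun ω hω => ?_), measureReal_empty]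
  simp only [Set.mem_empty_iff_false, iff_false]
  intro hD
  exact ((rim_facts_of_mem_dat hab hUb hω hD).1 r hr).2.1 hrb

end Summit.CriticalPhenomena.PercolationContinuityZ3.Theorems.Crossing

end
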